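import Literature.AlgebraicGeometry.Milne1999.CMTypeSimpleIsogenyFactors
import HarnessLib

/-!
# A simple abelian variety with `dim_ℚ End⁰(A) < 2 dim A` is not of CM type (Milne 1999 §2; Mumford §19)

Family `hodge`, layer `Literature/AlgebraicGeometry/Milne1999` (cell `pub-hodgeav-hg6`, req-37 (A) Q2b; eng-3 g3 — the
discharge of the displayed domain datum `¬ IsOfCMType A` of the TABLE X census rows whose members are simple with a small
endomorphism algebra, e.g. rows 9 ∕ 11 ∕ 13: Weil type with `End⁰ = K`, `E` quartic, `E` sextic on a sixfold:
`dim_ℚ End⁰ ∈ {2, 4, 6} < 12`). UNCONDITIONAL; theorems only, no definition, no named fact, no `sorry`.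
HONEST FRAMING of that cell: HC ∕ HC_AV ∕ HC_CM NOT proved — a statement about `End⁰(A)`.

* `not_isOfCMType_of_isSimple_of_finrank_endAlgebra_lt` — `A` simple, `0 < dim A`, `dim_ℚ End⁰(A) < 2 dim A` ⟹ `A` is not of
  CM type (Milne's clause: a simple abelian variety of CM type has `End⁰(A)` a field of degree `2 dim A`, the tree's
  `isOfCMType_iff_isOfCMTypeSimple`).
* `not_isOfCMType_of_isSimple_of_finrank_endAlgebra_le_dim` — the frequent special case `dim_ℚ End⁰(A) ≤ dim A`.

## References
* [Milne1999] J. S. Milne, Lefschetz motives and the Tate conjecture, Compositio Math. 117 (1999), §2 p. 54.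
* [MumfordAV1970] D. Mumford, Abelian varieties (1970), §19 Cor. 2 of Thm. 1 (p. 174) and §22 (p. 212).
-/

noncomputable section

namespace Literature.AlgebraicGeometry.Milne1999

open Literature.AlgebraicGeometry.Motives

variable {A : AbelianVariety ℂ}

/-- **A simple abelian variety with `dim_ℚ End⁰(A) < 2 dim A` is not of CM type** (a simple CM abelian variety has
`End⁰(A)` a CM field of degree exactly `2 dim A`). [cite: Milne1999, §2 p. 54] [cite: MumfordAV1970, §22 (p. 212)] -/
theorem not_isOfCMType_of_isSimple_of_finrank_endAlgebra_lt (hS : AbelianVariety.IsSimple A) (hA0 : 0 < A.dim)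
    (hE : Module.finrank ℚ A.endAlgebra < 2 * A.dim) : ¬ IsOfCMType A := fun hCM => by
  have h := ((isOfCMType_iff_isOfCMTypeSimple hS hA0).1 hCM).2
  omega

/-- **A simple abelian variety with `dim_ℚ End⁰(A) ≤ dim A` is not of CM type.** [cite: Milne1999, §2 p. 54]
[cite: MumfordAV1970, §22 (p. 212)] -/
theorem not_isOfCMType_of_isSimple_of_finrank_endAlgebra_le_dim (hS : AbelianVariety.IsSimple A) (hA0 : 0 < A.dim)
    (hE : Module.finrank ℚ A.endAlgebra ≤ A.dim) : ¬ IsOfCMType A :=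
  not_isOfCMType_of_isSimple_of_finrank_endAlgebra_lt hS hA0 (by omega)

end Literature.AlgebraicGeometry.Milne1999
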